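import Literature.MathematicalPhysics.QuantumLattice.HubbardTTPrimeGrandCanonicalPressureZeeman
import Literature.MathematicalPhysics.QuantumLattice.HubbardTTPrimeGrandCanonicalPressureTorusBridge
import Literature.MathematicalPhysics.QuantumLattice.GibbsLogPartitionTemperatureCouplingConvexity
import Literature.MathematicalPhysics.QuantumLattice.TorusSectorGibbsScaleCovariance
import Literature.MathematicalPhysics.QuantumLattice.TorusSectorGibbsParticleHole
import Literature.MathematicalPhysics.QuantumLattice.DWaveSourceThermalGibbsTorusLimit
import HarnessLib

/-!
# The grand-canonical Gibbs state of the `t–t'` Hubbard torus with chemical potential and Zeeman field,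
# as an eigen-mixture: `mixture = Gibbs state`, the joint temperature × coupling tangent plane, and the
# square-torus dictionary of the Zeeman grand-canonical pressure

Family `hubbard` (topic `MathematicalPhysics/QuantumLattice`; namespace
`Literature.MathematicalPhysics.QuantumLattice`). Stage S2 of the Hubbard material oracle («certifier families …
`T > 0`», D-0096 (ii)/(iii)): the companion of the NUMBERS `gcPressureTT'` / `gcPressureTT'Zeeman`
(`HubbardTTPrimeGrandCanonicalPressure{,Zeeman}`: `P(β; t,t',U; μ,h) = lim L⁻² log Re Z_β(H_L − μN − hM)`) on the
side of STATES. The thermal object is the grand-canonical Gibbs state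
`ρ_{L,β} = e^{−βK_L}/tr e^{−βK_L}` of

  `K_L(t,t',U,μ,h) = hubbardTorusTT' L t t' U − μ·totalNumber − h·spinImbalance`   (`gcTorusHamiltonianTT'`)

on the whole Fock space of the `L × L` torus, written — exactly as the canonical sector states of
`TorusSectorGibbsMixture` and the pair-sourced states of `DWaveSourceThermalGibbsMixtureDefs`, whose component count
`sourcedGibbsCount L = 4^{L²}` and index `sourcedGibbsIndex` (all Fock configurations = the trivial coordinate sector)
are REUSED — as the finite mixture of an orthonormal eigenbasis of `K_L` with Boltzmann weights, in the format
`(m, p, ψ)` of `InfVolFermionState.IsTorusLimitOfMixture`: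

* §1 `gcTorusHamiltonianTT'`: Hermitian, LINEAR in `(t,t',U,μ,h) ∈ ℝ⁵`
  (`gcTorusHamiltonianTT'_eq_smul_add`: `K_L = t·K₁ + t'·K₂ + U·D − μ·N − h·M`, `gcTorusHamiltonianTT'_linear`,
  `smul_gcTorusHamiltonianTT'_sub_smul`), `N = N↑ + N↓`, `M = N↑ − N↓`.
* §2 `gcGibbsEnergyTT'`, `gcGibbsVectorTT'`, `gcGibbsWeightTT' β`: eigenvalues, orthonormal eigenvectors, Boltzmann
  weights (`≥ 0`, sum `1`); **the mixture IS the Gibbs state on every observable**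
  (`sum_gcGibbsWeightTT'_mul_expect_eq_gibbsState`: `Σ_i p_{L,i}⟨ψ_{L,i}, Bψ_{L,i}⟩ = gibbsState β K_L B` — so nothing
  below depends on Mathlib's choice of eigenbasis); the finite-volume energy–entropy cap
  `Σ_i p_{L,i}E_{L,i} ≤ E₀(K_L) + L²(log 4)/β`; and **THE JOINT TEMPERATURE × COUPLING TANGENT PLANE**
  (Peierls–Bogoliubov at the scaled anchor, `GibbsLogPartitionTemperatureCouplingConvexity`): for all real `β, β₁` and
  coupling points `x, x₁ ∈ ℝ⁵`,
  `log Re Z_β(K_L(x)) − Re⟨β₁K_L(x₁) − βK_L(x)⟩_{β,K_L(x)} ≤ log Re Z_{β₁}(K_L(x₁))`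
  (`log_partitionFn_gcTorus_ge_tangent_temperature`, mixture form `…_ge_tangent_mixture`).
* §3 **square torus = rectangular torus** for the Zeeman grand-canonical partition function
  (`partitionFn_gcTorusHamiltonianTT'_re_eq_rect`, extending `partitionFn_grandCanonical_hubbardTorusTT'_re_eq_rect` to
  `h ≠ 0`), hence `(Ls j)⁻² log Re Z_β(K_{Ls j}) → gcPressureTT'Zeeman β t t' U μ h` along every `Ls → ∞`
  (`tendsto_log_partitionFn_gcTorus_div_sq_comp`, `β ≥ 0`, `U ≥ 0`): Zeeman grand-canonical certificates stated on
  `hubbardTorusTT'` (the `FermionTorus 2 L` spelling of the torus-limit states) bind the number.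

The thermodynamic limits of these mixtures (the class of THERMAL GRAND-CANONICAL STATES), the tangent plane for
states and the Griffiths brackets are in the companion `HubbardTTPrimeGrandCanonicalThermalStates`.
Four definitions with body (`gcTorusHamiltonianTT'`, `gcGibbs{Energy,Vector,Weight}TT'`); everything else PROVED; no
named fact, no sorry, no instance, no notation. WHAT THIS IS NOT: a KMS / infinite-volume Gibbs construction; a number
of record; a certificate.

## Mathlib / tree search

`lean search 'gcGibbs|grandCanonicalGibbs|IsTorusLimitOfMixture.*gc'`: no grand-canonical Gibbs mixture of the unsourced
`t–t'` torus (the pair-sourced `sourcedGibbs*TT'` of `DWaveSourceThermalGibbsMixtureDefs` is the `t = 1`, `h_pair ≠ 0`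
object without Zeeman field; the thermal rows of record `sectorGibbs*TT'` are canonical) (2026-08-27). REUSED:
`sectorEigenvalue/sectorEigenvector/canonicalWeight`, `star_sectorEigenvector_dotProduct`, `mulVec_sectorEigenvector`,
`re_rayleigh_sectorEigenvector`, `sum_canonicalWeight`, `sum_canonicalWeight_mul_re_rayleigh_le` (`TorusSectorGibbsMixture`),
`sum_canonicalWeight_mul_expect_sectorEigenvector_eq_gibbsState` (`TorusSectorGibbsScaleCovariance`),
`gibbsState_submatrix_equiv`, `gibbsState_congr_inst` (`TorusSectorGibbsParticleHole`), `sourcedGibbsCount/Index`,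
`canonicalWeight_comp_equiv'`, `log_sourcedGibbsCount_le` (`DWaveSourceThermalGibbs*`), `hubbardTorusTT'_eq_smul_add`
(`HubbardTTPrimeTorusFreeEnergyConcavity`), `log_partitionFn_linear_ge_tangent_temperature`
(`GibbsLogPartitionTemperatureCouplingConvexity`), `partitionFn_sub_sub_re_eq_sum`, `isHermitian_sub_sub`,
`tendsto_torusGCPressureTT'Zeeman_comp` (`HubbardTTPrimeGrandCanonicalPressureZeeman`),
`partitionFn_spinSector_hubbardTorusTT'_eq_rect`, `card_rectSites`, `preservesSectors_hamiltonian`.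

## References

* R. B. Israel, *Convexity in the Theory of Lattice Gases* (1979), §I.3 eq. (26) (periodic-boundary-condition Gibbs
  state), Lemma II.3.1 (finite-volume variational principle), Thm. I.3.4 (convexity of the pressure).
  [cite: Israel1979, §I.3 eq. (26)]
* E. H. Lieb, Adv. Math. 11 (1973) 267, §V (5.2)–(5.4) (Peierls–Bogoliubov inequalities).
  [cite: Lieb1973, §V (5.2)–(5.4)]
* D. Ruelle, *Statistical Mechanics: Rigorous Results* (1969), §3.4 (grand-canonical pressure; density and
  chemical potential). [cite: Ruelle1969, §3.4]
* H. Xu et al., Science 384 (2024) eadh7691, eq. (1) (the `t–t'` Hubbard Hamiltonian). [cite: XuEtAl2024, eq. (1)]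
* E. H. Lieb, Phys. Rev. Lett. 62 (1989) 1201, proof of Theorem 1 (the `(N↑, N↓)` sectors). [cite: LiebPRL1989, proof of Theorem 1]
* F. H. L. Essler et al., *The One-Dimensional Hubbard Model* (2005), §2.2.1 (site relabellings of the Hubbard
  Hamiltonian). [cite: EsslerEtAl2005, §2.2.1 eqs. (2.32)–(2.39)]
-/

noncomputable section

namespace Literature.MathematicalPhysics.QuantumLattice

open Matrix Finset HubbardWave0 Literature.Probability.LatticeModels ThermodynamicLimit LiebThm1
open _root_.Filter
open scoped _root_.Topology ComplexOrder BigOperators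

/-! ### §1 The grand-canonical torus Hamiltonian with chemical potential and Zeeman field -/

section Hamiltonian

variable (L : ℕ)

/-- **The grand-canonical `t–t'` torus Hamiltonian with chemical potential and Zeeman field**:
`K_L(t,t',U,μ,h) = H_L(t,t',U) − μ N − h (N↑ − N↓)` on the Fock space of the `L × L` torus
(`hubbardTorusTT'`, `totalNumber`, `spinImbalance`). [cite: Ruelle1969, §3.4] -/
def gcTorusHamiltonianTT' (t t' U μ hz : ℝ) :
    Matrix (Finset (Orb (FermionTorus 2 L))) (Finset (Orb (FermionTorus 2 L))) ℂ :=
  hubbardTorusTT' L t t' U - (μ : ℂ) • totalNumber - (hz : ℂ) • spinImbalance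

/-- Unfolding lemma. [cite: Ruelle1969, §3.4] -/
theorem gcTorusHamiltonianTT'_eq (t t' U μ hz : ℝ) :
    gcTorusHamiltonianTT' L t t' U μ hz =
      hubbardTorusTT' L t t' U - (μ : ℂ) • totalNumber - (hz : ℂ) • spinImbalance := rfl

/-- `K_L` is Hermitian. [cite: Ruelle1969, §3.4] -/
theorem gcTorusHamiltonianTT'_isHermitian (t t' U μ hz : ℝ) :
    (gcTorusHamiltonianTT' L t t' U μ hz).IsHermitian :=
  isHermitian_sub_sub (hubbardTorusTT'_isHermitian L t t' U) μ hz

/-- **`K_L` is linear in its five couplings**: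
`K_L(t,t',U,μ,h) = t·K₁ + t'·K₂ + U·D − μ·N − h·M` with `K₁, K₂` the unit nearest-neighbour / diagonal
hopping Hamiltonians, `D = Σₓ nₓ↑nₓ↓`, `N` the particle number, `M = N↑ − N↓`. [cite: XuEtAl2024, eq. (1)] -/
theorem gcTorusHamiltonianTT'_eq_smul_add (t t' U μ hz : ℝ) :
    gcTorusHamiltonianTT' L t t' U μ hz =
      (t : ℂ) • hamiltonian (fermionTorusGraph 2 L) 1 0 +
        (t' : ℂ) • hamiltonian (fermionTorusDiagGraph L) 1 0 +
          (U : ℂ) • (∑ x : FermionTorus 2 L, numberOp x 0 * numberOp x 1) -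
            (μ : ℂ) • totalNumber - (hz : ℂ) • spinImbalance := by
  rw [gcTorusHamiltonianTT', hubbardTorusTT'_eq_smul_add]

/-- The family `(t,t',U,μ,h) ↦ K_L` is LINEAR over `ℝ⁵` (all real `a, b`). [cite: XuEtAl2024, eq. (1)] -/
theorem gcTorusHamiltonianTT'_linear (x y : ℝ × ℝ × ℝ × ℝ × ℝ) (a b : ℝ) :
    gcTorusHamiltonianTT' L (a • x + b • y).1 (a • x + b • y).2.1 (a • x + b • y).2.2.1
        (a • x + b • y).2.2.2.1 (a • x + b • y).2.2.2.2 =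
      (a : ℂ) • gcTorusHamiltonianTT' L x.1 x.2.1 x.2.2.1 x.2.2.2.1 x.2.2.2.2 +
        (b : ℂ) • gcTorusHamiltonianTT' L y.1 y.2.1 y.2.2.1 y.2.2.2.1 y.2.2.2.2 := by
  simp only [gcTorusHamiltonianTT'_eq_smul_add, Prod.smul_fst, Prod.smul_snd, Prod.fst_add, Prod.snd_add,
    smul_eq_mul, Complex.ofReal_add, Complex.ofReal_mul]
  module

/-- **Coupling × temperature increments**:
`β₁K_L(x₁) − βK_L(x) = (β₁t₁−βt)K₁ + (β₁t'₁−βt')K₂ + (β₁U₁−βU)D − (β₁μ₁−βμ)N − (β₁h₁−βh)M`.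
[cite: XuEtAl2024, eq. (1)] -/
theorem smul_gcTorusHamiltonianTT'_sub_smul (β β₁ t t' U μ hz t₁ t'₁ U₁ μ₁ h₁ : ℝ) :
    (β₁ : ℂ) • gcTorusHamiltonianTT' L t₁ t'₁ U₁ μ₁ h₁ - (β : ℂ) • gcTorusHamiltonianTT' L t t' U μ hz =
      ((β₁ * t₁ - β * t : ℝ) : ℂ) • hamiltonian (fermionTorusGraph 2 L) 1 0 +
        ((β₁ * t'₁ - β * t' : ℝ) : ℂ) • hamiltonian (fermionTorusDiagGraph L) 1 0 +
          ((β₁ * U₁ - β * U : ℝ) : ℂ) • (∑ x : FermionTorus 2 L, numberOp x 0 * numberOp x 1) -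
            ((β₁ * μ₁ - β * μ : ℝ) : ℂ) • totalNumber - ((β₁ * h₁ - β * hz : ℝ) : ℂ) • spinImbalance := by
  simp only [gcTorusHamiltonianTT'_eq_smul_add, Complex.ofReal_sub, Complex.ofReal_mul]
  module

/-- `K_L(1,0,0,0,0) = K₁`, `K_L(0,1,0,0,0) = K₂`, `K_L(0,0,1,0,0) = D` in the form used below:
`hubbardTorusTT' L 1 0 0 = K₁` etc. [cite: XuEtAl2024, eq. (1)] -/
theorem hubbardTorusTT'_one_zero_zero :
    hubbardTorusTT' L 1 0 0 = hamiltonian (fermionTorusGraph 2 L) 1 0 := by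
  rw [hubbardTorusTT'_eq_smul_add]; simp

/-- `hubbardTorusTT' L 0 1 0 = K₂`. [cite: XuEtAl2024, eq. (1)] -/
theorem hubbardTorusTT'_zero_one_zero :
    hubbardTorusTT' L 0 1 0 = hamiltonian (fermionTorusDiagGraph L) 1 0 := by
  rw [hubbardTorusTT'_eq_smul_add]; simp

/-- **The total number is the sum of the two spin numbers**: `N = Σ_σ Σ_y n_{yσ}`. [cite: Lieb1995] -/
theorem totalNumber_eq_sum_spin_sum :
    (totalNumber : Matrix (Finset (Orb (FermionTorus 2 L))) (Finset (Orb (FermionTorus 2 L))) ℂ) =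
      (∑ y : FermionTorus 2 L, numberOp y 0) + ∑ y : FermionTorus 2 L, numberOp y 1 := by
  rw [totalNumber, ← Finset.sum_add_distrib]
  refine Finset.sum_congr rfl fun y _ => ?_
  rw [Fin.sum_univ_two]

/-- `M = Σ_y n_{y↑} − Σ_y n_{y↓}`. [cite: LiebPRL1989, proof of Theorem 1] -/
theorem spinImbalance_eq_sum_sub_sum :
    (spinImbalance : Matrix (Finset (Orb (FermionTorus 2 L))) (Finset (Orb (FermionTorus 2 L))) ℂ) =
      (∑ y : FermionTorus 2 L, numberOp y 0) - ∑ y : FermionTorus 2 L, numberOp y 1 := by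
  rw [spinImbalance, Finset.sum_sub_distrib]

end Hamiltonian

/-! ### §2 The grand-canonical Gibbs state of the torus as an eigen-mixture -/

section Mixture

variable (β t t' U μ hz : ℝ) (L : ℕ)

/-- The energies of the grand-canonical Gibbs mixture: the eigenvalues of `K_L(t,t',U,μ,h)`, indexed by
`Fin (sourcedGibbsCount L)` (`sourcedGibbsCount L = 4^{L²}` = all Fock configurations of the torus, the
trivial coordinate sector of `TorusSectorGibbsMixture` §1, as in `DWaveSourceThermalGibbsMixtureDefs`).
[cite: Israel1979, Lemma II.3.1] -/
def gcGibbsEnergyTT' (i : Fin (sourcedGibbsCount L)) : ℝ :=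
  sectorEigenvalue (fun _ => True) (gcTorusHamiltonianTT' L t t' U μ hz)
    (gcTorusHamiltonianTT'_isHermitian L t t' U μ hz) (sourcedGibbsIndex L i)

/-- The components of the grand-canonical Gibbs mixture: an orthonormal eigenbasis of `K_L(t,t',U,μ,h)`.
[cite: Israel1979, Lemma II.3.1] -/
def gcGibbsVectorTT' (i : Fin (sourcedGibbsCount L)) : Fock (Orb (FermionTorus 2 L)) :=
  sectorEigenvector (fun _ => True) (gcTorusHamiltonianTT' L t t' U μ hz)
    (gcTorusHamiltonianTT'_isHermitian L t t' U μ hz) (sourcedGibbsIndex L i)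

/-- **The Boltzmann weights of the grand-canonical Gibbs state** `ρ_{L,β} = e^{−βK_L}/tr e^{−βK_L}` of
`K_L(t,t',U,μ,h)`: `p_{L,i}(β) = e^{−βE_{L,i}} / Σ_j e^{−βE_{L,j}}`. [cite: Israel1979, §I.3 eq. (26)] -/
def gcGibbsWeightTT' (i : Fin (sourcedGibbsCount L)) : ℝ :=
  canonicalWeight β (gcGibbsEnergyTT' t t' U μ hz L) i

/-- The components are orthonormal. [cite: Israel1979, Lemma II.3.1] -/
theorem star_gcGibbsVectorTT'_dotProduct (i j : Fin (sourcedGibbsCount L)) :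
    star (gcGibbsVectorTT' t t' U μ hz L i) ⬝ᵥ gcGibbsVectorTT' t t' U μ hz L j = if i = j then 1 else 0 := by
  rw [gcGibbsVectorTT', gcGibbsVectorTT', star_sectorEigenvector_dotProduct]
  simp only [EmbeddingLike.apply_eq_iff_eq]

/-- The components are unit vectors. [cite: Israel1979, Lemma II.3.1] -/
theorem star_gcGibbsVectorTT'_dotProduct_self (i : Fin (sourcedGibbsCount L)) :
    star (gcGibbsVectorTT' t t' U μ hz L i) ⬝ᵥ gcGibbsVectorTT' t t' U μ hz L i = 1 := by
  rw [star_gcGibbsVectorTT'_dotProduct, if_pos rfl]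

/-- The components are eigenvectors: `K_L ψ_{L,i} = E_{L,i} ψ_{L,i}`. [cite: Israel1979, Lemma II.3.1] -/
theorem gcTorusHamiltonianTT'_mulVec_gcGibbsVectorTT' (i : Fin (sourcedGibbsCount L)) :
    gcTorusHamiltonianTT' L t t' U μ hz *ᵥ gcGibbsVectorTT' t t' U μ hz L i =
      ((gcGibbsEnergyTT' t t' U μ hz L i : ℝ) : ℂ) • gcGibbsVectorTT' t t' U μ hz L i :=
  mulVec_sectorEigenvector (fun _ => True) _ (fun _ _ hs _ => (hs trivial).elim) _

/-- The mean energy of a component is its energy: `Re⟨ψ_{L,i}, K_L ψ_{L,i}⟩ = E_{L,i}`.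
[cite: Israel1979, Lemma II.3.1] -/
theorem re_expect_gcGibbsVectorTT' (i : Fin (sourcedGibbsCount L)) :
    (expect (gcTorusHamiltonianTT' L t t' U μ hz) (gcGibbsVectorTT' t t' U μ hz L i)).re =
      gcGibbsEnergyTT' t t' U μ hz L i :=
  re_rayleigh_sectorEigenvector (fun _ => True) _ (fun _ _ hs _ => (hs trivial).elim) _

/-- The Gibbs weights are nonnegative. [cite: Israel1979, Lemma II.3.1] -/
theorem gcGibbsWeightTT'_nonneg (i : Fin (sourcedGibbsCount L)) :
    0 ≤ gcGibbsWeightTT' β t t' U μ hz L i :=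
  canonicalWeight_nonneg β _ i

/-- The Gibbs weights sum to one. [cite: Israel1979, Lemma II.3.1] -/
theorem sum_gcGibbsWeightTT' : ∑ i, gcGibbsWeightTT' β t t' U μ hz L i = 1 := by
  haveI : Nonempty (Fin (sourcedGibbsCount L)) := ⟨(sourcedGibbsIndex L).symm ⟨∅, trivial⟩⟩
  exact sum_canonicalWeight β _

/-- **The eigen-mixture IS the Gibbs state, on every observable** (basis-free form):
`Σ_i p_{L,i}(β) ⟨ψ_{L,i}, B ψ_{L,i}⟩ = tr(e^{−βK_L} B)/tr e^{−βK_L} = gibbsState β K_L B` for every matrix `B`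
(`sum_canonicalWeight_mul_expect_sectorEigenvector_eq_gibbsState` on the trivial sector, reindexed along
`{s // True} ≃ Finset (Orb Λ)`). [cite: Israel1979, §I.3 eq. (26)] -/
theorem sum_gcGibbsWeightTT'_mul_expect_eq_gibbsState
    (B : Matrix (Finset (Orb (FermionTorus 2 L))) (Finset (Orb (FermionTorus 2 L))) ℂ) :
    ∑ i, (gcGibbsWeightTT' β t t' U μ hz L i : ℂ) * expect B (gcGibbsVectorTT' t t' U μ hz L i) =
      gibbsState β (gcTorusHamiltonianTT' L t t' U μ hz) B := by
  set K := gcTorusHamiltonianTT' L t t' U μ hz with hKdef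
  have hK : K.IsHermitian := gcTorusHamiltonianTT'_isHermitian L t t' U μ hz
  set e := sourcedGibbsIndex L with he
  set E := sectorEigenvalue (fun _ => True) K hK with hE
  have hw : ∀ i, gcGibbsWeightTT' β t t' U μ hz L i = canonicalWeight β E (e i) := by
    intro i
    rw [gcGibbsWeightTT', show gcGibbsEnergyTT' t t' U μ hz L = E ∘ e from funext fun i => rfl,
      canonicalWeight_comp_equiv']
  have hv : ∀ i, gcGibbsVectorTT' t t' U μ hz L i = sectorEigenvector (fun _ => True) K hK (e i) := fun i => rfl
  simp_rw [hw, hv]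
  rw [Equiv.sum_comp e (fun a => (canonicalWeight β E a : ℂ) *
    expect B (sectorEigenvector (fun _ => True) K hK a))]
  have h := sum_canonicalWeight_mul_expect_sectorEigenvector_eq_gibbsState (fun _ => True) K hK β B
  rw [hE]
  refine h.trans ?_
  classical
  have h2 := gibbsState_submatrix_equiv β K B
    (Equiv.subtypeUnivEquiv (fun _ => trivial) : {s : Finset (Orb (FermionTorus 2 L)) // True} ≃ _)
  have hcoe : (⇑(Equiv.subtypeUnivEquiv (fun _ => trivial) : {s : Finset (Orb (FermionTorus 2 L)) // True} ≃ _) :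
      {s : Finset (Orb (FermionTorus 2 L)) // True} → Finset (Orb (FermionTorus 2 L))) = Subtype.val := rfl
  rw [hcoe] at h2
  convert h2 using 1
  exact gibbsState_congr_inst _ _ _ _ _ _ _

/-- Real-part form: `Σ_i p_{L,i}(β) Re⟨ψ_{L,i}, B ψ_{L,i}⟩ = Re ⟨B⟩_{β, K_L}`. [cite: Israel1979, §I.3 eq. (26)] -/
theorem sum_gcGibbsWeightTT'_mul_re_expect_eq
    (B : Matrix (Finset (Orb (FermionTorus 2 L))) (Finset (Orb (FermionTorus 2 L))) ℂ) :
    ∑ i, gcGibbsWeightTT' β t t' U μ hz L i * (expect B (gcGibbsVectorTT' t t' U μ hz L i)).re =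
      (gibbsState β (gcTorusHamiltonianTT' L t t' U μ hz) B).re := by
  rw [← sum_gcGibbsWeightTT'_mul_expect_eq_gibbsState, Complex.re_sum]
  refine Finset.sum_congr rfl fun i _ => ?_
  rw [Complex.re_ofReal_mul]

/-- **Finite-volume energy–entropy cap**: `Σ_i p_{L,i} E_{L,i} ≤ E₀(K_L) + L²(log 4)/β` (`β > 0`; Gibbs'
variational principle with `S ≤ log dim = L² log 4`). [cite: Israel1979, Lemma II.3.1] -/
theorem sum_gcGibbsWeightTT'_mul_re_expect_le_log_four (hβ : 0 < β) :
    ∑ i, gcGibbsWeightTT' β t t' U μ hz L i *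
        (expect (gcTorusHamiltonianTT' L t t' U μ hz) (gcGibbsVectorTT' t t' U μ hz L i)).re ≤
      (gcTorusHamiltonianTT' L t t' U μ hz).groundEnergy + Real.log 4 * (L : ℝ) ^ 2 / β := by
  set K := gcTorusHamiltonianTT' L t t' U μ hz with hKdef
  have hK : K.IsHermitian := gcTorusHamiltonianTT'_isHermitian L t t' U μ hz
  have hinv : ∀ s s' : Finset (Orb (FermionTorus 2 L)), ¬ (fun _ => True) s → (fun _ => True) s' → K s s' = 0 :=
    fun _ _ hs _ => (hs trivial).elim
  have hp : ∃ s : Finset (Orb (FermionTorus 2 L)), (fun _ => True) s := ⟨∅, trivial⟩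
  have hT : ∀ v : Fock (Orb (FermionTorus 2 L)), v ∈ (⊤ : Submodule ℂ (Fock (Orb (FermionTorus 2 L)))) ↔
      ∀ s, ¬ (fun _ : Finset (Orb (FermionTorus 2 L)) => True) s → v s = 0 :=
    fun v => ⟨fun _ s hs => (hs trivial).elim, fun _ => Submodule.mem_top⟩
  have hcap := sum_canonicalWeight_mul_re_rayleigh_le (fun _ => True) hK hinv hp ⊤ hT hβ
  rw [Matrix.minEnergyOn_top_holds hK] at hcap
  set e := sourcedGibbsIndex L with he
  have hsum : ∑ i, gcGibbsWeightTT' β t t' U μ hz L i * (expect K (gcGibbsVectorTT' t t' U μ hz L i)).re =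
      ∑ a, canonicalWeight β (sectorEigenvalue (fun _ => True) K hK) a *
        (star (sectorEigenvector (fun _ => True) K hK a) ⬝ᵥ
          (K *ᵥ sectorEigenvector (fun _ => True) K hK a)).re := by
    rw [← Equiv.sum_comp e]
    refine Finset.sum_congr rfl fun i _ => ?_
    rw [gcGibbsWeightTT', show gcGibbsEnergyTT' t t' U μ hz L =
      sectorEigenvalue (fun _ => True) K hK ∘ e from funext fun i => rfl, canonicalWeight_comp_equiv']
    rfl
  have hcard : (Fintype.card (Subtype (fun _ : Finset (Orb (FermionTorus 2 L)) => True)) : ℝ) =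
      (sourcedGibbsCount L : ℝ) := rfl
  rw [hsum]
  refine hcap.trans ?_
  rw [hcard]
  gcongr
  exact log_sourcedGibbsCount_le L

/-- **The joint temperature × coupling tangent plane of the grand-canonical torus** (Peierls–Bogoliubov at the
scaled anchor `β K_L(x)`, read at `β₁ K_L(x₁)`): for all real `β, β₁` and couplings `x = (t,t',U,μ,h)`,
`x₁ = (t₁,t'₁,U₁,μ₁,h₁)`,
`log Re Z_β(K_L(x)) − Re⟨β₁K_L(x₁) − βK_L(x)⟩_{β, K_L(x)} ≤ log Re Z_{β₁}(K_L(x₁))`.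
[cite: Lieb1973, §V (5.2)–(5.4)] [cite: Israel1979, Thm. I.3.4] -/
theorem log_partitionFn_gcTorus_ge_tangent_temperature (β₁ t₁ t'₁ U₁ μ₁ h₁ : ℝ) :
    Real.log (partitionFn β (gcTorusHamiltonianTT' L t t' U μ hz)).re -
        (gibbsState β (gcTorusHamiltonianTT' L t t' U μ hz)
          ((β₁ : ℂ) • gcTorusHamiltonianTT' L t₁ t'₁ U₁ μ₁ h₁ -
            (β : ℂ) • gcTorusHamiltonianTT' L t t' U μ hz)).re ≤
      Real.log (partitionFn β₁ (gcTorusHamiltonianTT' L t₁ t'₁ U₁ μ₁ h₁)).re := by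
  have h := log_partitionFn_linear_ge_tangent_temperature
    (H := fun q : ℝ × ℝ × ℝ × ℝ × ℝ => gcTorusHamiltonianTT' L q.1 q.2.1 q.2.2.1 q.2.2.2.1 q.2.2.2.2)
    (fun x y a b => gcTorusHamiltonianTT'_linear L x y a b)
    (fun q => gcTorusHamiltonianTT'_isHermitian L q.1 q.2.1 q.2.2.1 q.2.2.2.1 q.2.2.2.2) β₁ β
    (t₁, t'₁, U₁, μ₁, h₁) (t, t', U, μ, hz)
  simpa only using h

/-- The `K`-energy of a vector splits by coupling: `Re⟨ψ, K_L ψ⟩ = Re⟨ψ, H_Lψ⟩ − μ Re⟨ψ, Nψ⟩ − h Re⟨ψ, Mψ⟩`.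
[cite: Ruelle1969, §3.4] -/
theorem re_expect_gcTorusHamiltonianTT' (ψ : Fock (Orb (FermionTorus 2 L))) :
    (expect (gcTorusHamiltonianTT' L t t' U μ hz) ψ).re =
      (expect (hubbardTorusTT' L t t' U) ψ).re - μ * (expect totalNumber ψ).re -
        hz * (expect spinImbalance ψ).re := by
  rw [gcTorusHamiltonianTT', expect, expect, expect, expect, Matrix.sub_mulVec, Matrix.sub_mulVec,
    Matrix.smul_mulVec, Matrix.smul_mulVec, dotProduct_sub, dotProduct_sub, dotProduct_smul,
    dotProduct_smul, Complex.sub_re, Complex.sub_re, smul_eq_mul, smul_eq_mul, Complex.re_ofReal_mul,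
    Complex.re_ofReal_mul]

/-- **Mixture form of the tangent plane**: with the Gibbs weights `p_{L,i}(β)` and components `ψ_{L,i}` of `K_L(x)`,
`log Re Z_β(K_L(x)) − [β₁ Σ_i p_{L,i} Re⟨ψ_{L,i}, K_L(x₁)ψ_{L,i}⟩ − β Σ_i p_{L,i} Re⟨ψ_{L,i}, K_L(x)ψ_{L,i}⟩]
  ≤ log Re Z_{β₁}(K_L(x₁))`. [cite: Lieb1973, §V (5.2)–(5.4)] -/
theorem log_partitionFn_gcTorus_ge_tangent_mixture (β₁ t₁ t'₁ U₁ μ₁ h₁ : ℝ) :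
    Real.log (partitionFn β (gcTorusHamiltonianTT' L t t' U μ hz)).re -
        (β₁ * ∑ i, gcGibbsWeightTT' β t t' U μ hz L i *
            (expect (gcTorusHamiltonianTT' L t₁ t'₁ U₁ μ₁ h₁) (gcGibbsVectorTT' t t' U μ hz L i)).re -
          β * ∑ i, gcGibbsWeightTT' β t t' U μ hz L i *
            (expect (gcTorusHamiltonianTT' L t t' U μ hz) (gcGibbsVectorTT' t t' U μ hz L i)).re) ≤
      Real.log (partitionFn β₁ (gcTorusHamiltonianTT' L t₁ t'₁ U₁ μ₁ h₁)).re := by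
  have h := log_partitionFn_gcTorus_ge_tangent_temperature β t t' U μ hz L β₁ t₁ t'₁ U₁ μ₁ h₁
  rw [map_sub, map_smul, map_smul, smul_eq_mul, smul_eq_mul, Complex.sub_re, Complex.re_ofReal_mul,
    Complex.re_ofReal_mul, ← sum_gcGibbsWeightTT'_mul_re_expect_eq, ← sum_gcGibbsWeightTT'_mul_re_expect_eq] at h
  exact h

end Mixture

/-! ### §3 The square torus and the rectangular torus carry the same Zeeman grand-canonical partition function -/

section Bridge

/-- **Square torus = rectangular torus for the Zeeman grand-canonical partition function**:
`Re Z_β(K_L(t,t',U,μ,h)) = Re Z_β(hubbardRectTorusTT' L L t t' U − μN − hM)` (both are the same sum of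
sector partition functions, `partitionFn_sub_sub_re_eq_sum` + `partitionFn_spinSector_hubbardTorusTT'_eq_rect`).
[cite: EsslerEtAl2005, §2.2.1 eqs. (2.32)–(2.39)] -/
theorem partitionFn_gcTorusHamiltonianTT'_re_eq_rect (L : ℕ) (t t' U β μ hz : ℝ) :
    (partitionFn β (gcTorusHamiltonianTT' L t t' U μ hz)).re =
      (partitionFn β (hubbardRectTorusTT' L L t t' U - (μ : ℂ) • totalNumber - (hz : ℂ) • spinImbalance)).re := by
  have hP₁ : PreservesSectors (hubbardTorusTT' L t t' U) := by
    unfold hubbardTorusTT'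
    exact (preservesSectors_hamiltonian _ t U).add (preservesSectors_hamiltonian _ t' 0)
  have hP₂ : PreservesSectors (hubbardRectTorusTT' L L t t' U) := by
    unfold hubbardRectTorusTT'
    exact (preservesSectors_hamiltonian _ t U).add (preservesSectors_hamiltonian _ t' 0)
  have h₁ := partitionFn_sub_sub_re_eq_sum hP₁ β μ hz
  have h₂ := partitionFn_sub_sub_re_eq_sum hP₂ β μ hz
  have hc₁ : Fintype.card (FermionTorus 2 L) = L * L := by simp [FermionTorus, sq]
  have hc₂ : Fintype.card (Fin L ×ₗ Fin L) = L * L := card_rectSites L L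
  have e₁ : (partitionFn β (gcTorusHamiltonianTT' L t t' U μ hz)).re =
      ∑ a ∈ Finset.range (L * L + 1), ∑ b ∈ Finset.range (L * L + 1),
        Real.exp (β * μ * (a + b) + β * hz * (a - b)) *
          (partitionFn β (spinSectorHamiltonian a b (hubbardRectTorusTT' L L t t' U))).re := by
    calc (partitionFn β (gcTorusHamiltonianTT' L t t' U μ hz)).re
        = ∑ a ∈ Finset.range (Fintype.card (FermionTorus 2 L) + 1),
            ∑ b ∈ Finset.range (Fintype.card (FermionTorus 2 L) + 1),
              Real.exp (β * μ * (a + b) + β * hz * (a - b)) *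
                (partitionFn β (spinSectorHamiltonian a b (hubbardTorusTT' L t t' U))).re := by
          rw [gcTorusHamiltonianTT']
          convert h₁ using 4
      _ = _ := by
          rw [hc₁]
          refine Finset.sum_congr rfl fun a _ => Finset.sum_congr rfl fun b _ => ?_
          rw [partitionFn_spinSector_hubbardTorusTT'_eq_rect]
  have e₂ : (partitionFn β (hubbardRectTorusTT' L L t t' U - (μ : ℂ) • totalNumber - (hz : ℂ) • spinImbalance)).re =
      ∑ a ∈ Finset.range (L * L + 1), ∑ b ∈ Finset.range (L * L + 1),
        Real.exp (β * μ * (a + b) + β * hz * (a - b)) *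
          (partitionFn β (spinSectorHamiltonian a b (hubbardRectTorusTT' L L t t' U))).re := by
    calc (partitionFn β (hubbardRectTorusTT' L L t t' U - (μ : ℂ) • totalNumber - (hz : ℂ) • spinImbalance)).re
        = ∑ a ∈ Finset.range (Fintype.card (Fin L ×ₗ Fin L) + 1),
            ∑ b ∈ Finset.range (Fintype.card (Fin L ×ₗ Fin L) + 1),
              Real.exp (β * μ * (a + b) + β * hz * (a - b)) *
                (partitionFn β (spinSectorHamiltonian a b (hubbardRectTorusTT' L L t t' U))).re := by
          convert h₂ using 4
      _ = _ := by rw [hc₂]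
  rw [e₁, e₂]

variable {β : ℝ} (hβ : 0 ≤ β) (t t' : ℝ) {U : ℝ} (hU : 0 ≤ U) (μ hz : ℝ)
include hβ hU

/-- **The Zeeman grand-canonical pressure along the square tori**: for `β ≥ 0`, `U ≥ 0` and every `Ls → ∞`,
`(Ls j)⁻² log Re Z_β(K_{Ls j}(t,t',U,μ,h)) → gcPressureTT'Zeeman β t t' U μ h`. [cite: Ruelle1969, §3.4] -/
theorem tendsto_log_partitionFn_gcTorus_div_sq_comp {Ls : ℕ → ℕ} (hLs : Tendsto Ls atTop atTop) :
    Tendsto (fun j : ℕ => Real.log (partitionFn β (gcTorusHamiltonianTT' (Ls j) t t' U μ hz)).re /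
      ((Ls j : ℕ) : ℝ) ^ 2) atTop (𝓝 (gcPressureTT'Zeeman β t t' U μ hz)) := by
  refine (tendsto_torusGCPressureTT'Zeeman_comp hβ t t' hU μ hz hLs).congr fun j => ?_
  rw [partitionFn_gcTorusHamiltonianTT'_re_eq_rect]

end Bridge

end Literature.MathematicalPhysics.QuantumLattice

end
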